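import Summits.NavierStokesRegularity.NavierStokesRegularity.Theorems.ScalingDefectPeepholeDoorRigidityU
import HarnessLib

/-!
# ScalingDefectPeepholeDoorRigidityUHolds — door S30 «ScalingDefectPeepholeDoor», effective plate E0 BY NAME:
# `QuietVortexCoreRigidityU` holds

The closing file of the pressure-free Serrin chain (nsreg-p1 g25 ROUND-29 §7 / Sketch31 v2.1 Part B, text of
record `…ScalingDefectPeepholeDoorDefs` §6): **`quietVortexCoreRigidityU_holds : QuietVortexCoreRigidityU`** — LEG Cω
of door S30 with the lateness `s₁(C_u, θ, R)` fixed BEFORE the annular pressure level `C_p` ("the vorticity-side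
envelopes are pressure-free", ADDENDUM-28A) — from `coreVortexDefect_vorticity_small_U` exactly as the tree text
`quietVortexCoreRigidity_holds` (p615916) was obtained from `coreVortexDefect_vorticity_small`; and the tree order as
its corollary by `quietVortexCoreRigidity_of_U` (not restated here: `dedup.landed`).

Door S30 is a regularity CRITERION inside a HYPOTHETICAL local Type-I blow-up; item 0056 `NoTypeII`
stays OPEN; nothing here bears on NS regularity itself.
-/

noncomputable section

set_option linter.dupNamespace false

namespace Summit.NavierStokesRegularity.NavierStokesRegularity.Theorems.ScalingDefectPeepholeDoor

open MeasureTheory Set Function Filter Metric TopologicalSpace InnerProductSpace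
open scoped ENNReal NNReal InnerProductSpace RealInnerProductSpace Laplacian Topology
open Literature.Analysis Literature.Analysis.FluidPDE
open Summit.NavierStokesRegularity.NavierStokesRegularity.Theorems.StableStrataDoorDefs (physWindowField)

/-- **LEG Cω of door S30, EFFECTIVE ORDER, BY NAME: `QuietVortexCoreRigidityU` holds** — for `C_u, θ > 0, R ≥ 2`
there are `η > 0`, `L ≥ 1` AND a lateness `s₁ ≥ 1` such that for EVERY pressure level `C_p`, in Pineau–Vicol's class,
`‖vortexDefect 1 (physWindowField 0 0 u t̄) ·‖ ≤ η` on `B(0, L)` at ONE `t̄ ∈ (−e^{−s₁}, 0)` gives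
`∫_{B(0,2R√(−t̄))} |ω(t̄)|² ≤ θ²/(4√(−t̄))` (`coreVortexDefect_vorticity_small_U` with the window field
`physWindowField 0 0 u t̄ = √(−t̄) u(t̄, √(−t̄)·)`).  The pressure-free Serrin estimates (`Serrin.*`, steps E1–E4)
make the lateness uniform in `C_p`.  A regularity CRITERION's input inside a hypothetical local Type-I blow-up;
0056 stays OPEN. -/
theorem quietVortexCoreRigidityU_holds : QuietVortexCoreRigidityU := by
  intro Cu hCu θ hθ R hR
  obtain ⟨η, hη, L, hL, s₁, hs₁, H⟩ := coreVortexDefect_vorticity_small_U Cu hCu θ hθ R hR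
  refine ⟨η, hη, L, hL, s₁, hs₁, fun Cp hCp u p hreg hI hP tb htb1 htb0 hcore => ?_⟩
  have hW : physWindowField 0 0 u tb = fun w => Real.sqrt (-tb) • u tb (Real.sqrt (-tb) • w) := by
    funext w
    simp only [physWindowField, zero_sub, zero_add]
  refine H Cp hCp u p hreg hI hP tb htb1 htb0 fun W hWeq y hy => ?_
  have e : ssResidual 1 W = fun z => (1 : ℝ) • (Δ W) z - fderiv ℝ W z (W z) - (1 / 2 : ℝ) • W z
      - (1 / 2 : ℝ) • fderiv ℝ W z z := rfl
  have h := hcore y hy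
  rw [hW, ← hWeq] at h
  simp only [vortexDefect] at h
  rw [e] at h
  exact h

/- The tree order `QuietVortexCoreRigidity` follows again by `quietVortexCoreRigidity_of_U quietVortexCoreRigidityU_holds`
(not restated: `quietVortexCoreRigidity_holds`, p615916, is already in the tree). -/

end Summit.NavierStokesRegularity.NavierStokesRegularity.Theorems.ScalingDefectPeepholeDoor

end
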